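import Literature.AlgebraicGeometry.Motives.JacobianRiemannThetaDivisorHolds
import Literature.AlgebraicGeometry.Motives.JacobianBrillNoetherLocusSymmetric
import Literature.AlgebraicGeometry.Motives.JacobianStepOneTransport
import HarnessLib

/-!
# A SYMMETRIC Riemann theta divisor exists: `(−1)^*Θ ≈ Θ` for a principal polarisation theta divisor of the Jacobian

Layer `Literature/AlgebraicGeometry/Motives`, namespace `Literature.AlgebraicGeometry.Motives.Jacobian`.  KERNEL ONLY: theorems, no
definition, no named fact, no instance, no `sorry`.  Capstone over ★ `Motives/JacobianRiemannThetaDivisorHolds` (row VI-7: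
`riemann_brillNoetherLocus_isPrincipalPolarizationDivisor_holds` — a Riemann theta divisor which is a principal polarisation divisor
EXISTS) and ★ `Motives/JacobianBrillNoetherLocusSymmetric` ed. 2 (`exists_translate_brillNoetherLocus_symmetric` — a `[−1]`-symmetric
translate of `W̃_{g−1}` exists).

## The mathematics ([Lange2023AbelianVarietiesComplex] §4.2.2 Thm. 4.2.5, [MumfordAV1970] §6 and §13 (symmetric theta divisors))

For a smooth projective complex curve `C` of genus `g ≥ 1` with Jacobian `𝒥` and `P ∈ C(ℂ)`, take a Riemann theta divisor `Θ` which is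
a principal polarisation divisor, re-centre it so that `supp Θ₀ = W̃_{g−1}(P)` exactly (`Θ₀ = t_{x₁}^*Θ`), and translate once more by
the `κ′` of ★ `exists_translate_brillNoetherLocus_symmetric`: `Θ₁ := t_{κ′}^*Θ₀` has support `t_{κ′}⁻¹ W̃_{g−1}(P)`, a `[−1]`-symmetric
IRREDUCIBLE closed set.  Then `(−1)^*Θ₁` and `Θ₁` are effective principal polarisation divisors with the same irreducible support, hence
THE SAME DIVISOR (★ `AbelianVariety.IsPrincipalPolarizationDivisor.sameDivisor_of_support_eq`: Hartshorne II.6.11 + principality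
pins the multiplicity).  So **the Jacobian carries a SYMMETRIC Riemann theta divisor defining its canonical principal polarisation**
(Lange Thm. 4.2.5: `W_{g−1} = α_κ^*Θ` with `Θ` symmetric, `κ` a theta characteristic).

## What is proved
`Jacobian.exists_symmetric_isRiemannThetaDivisor`.  COUNT-NEUTRAL.  HC_CM is proved only modulo the 7 printed citations until rung 0 closes;
this file moves no book by itself.

## References
* [Lange2023AbelianVarietiesComplex] H. Lange, *Abelian Varieties over the Complex Numbers* (2023), §4.2.2 Thm. 4.2.5.
* [MumfordAV1970] D. Mumford, *Abelian Varieties* (1970), §6 Application 1 (pp. 60–61) (translates and pull-backs of divisors).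
* [Hartshorne1977] R. Hartshorne, *Algebraic Geometry* (1977), II.6 Prop. 6.11 and Remark 6.11.2 (pp. 141–142).
-/

set_option autoImplicit false

noncomputable section

open CategoryTheory AlgebraicGeometry

universe u

namespace Literature.AlgebraicGeometry.Motives

namespace Jacobian

open scoped MonObj

/-- **A SYMMETRIC Riemann theta divisor exists.**  For a smooth projective complex curve `C`, a Jacobian `𝒥` with `dim J ≥ 1` and a base
point `P ∈ C(ℂ)`, there is a Cartier divisor `Θ` on `J` which is a Riemann theta divisor (effective, support a translate of `W̃_{g−1}`), a
principal polarisation divisor, has support EXACTLY a translate-preimage `t_{κ′}⁻¹ W̃_{g−1}(P)`, and is SYMMETRIC: `(−1)^*Θ` is the same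
divisor as `Θ`.  (★ VI-7 `riemann_brillNoetherLocus_isPrincipalPolarizationDivisor_holds`, re-centring, ★
`exists_translate_brillNoetherLocus_symmetric`, ★ `IsPrincipalPolarizationDivisor.sameDivisor_of_support_eq`.)
[cite: Lange2023AbelianVarietiesComplex, §4.2.2 Thm. 4.2.5] [cite: Hartshorne1977, II.6 Prop. 6.11 and Remark 6.11.2 (pp. 141–142)] -/
theorem exists_symmetric_isRiemannThetaDivisor {C : SchemeOver ℂ} (hC : IsSmoothProjective 1 C) (𝒥 : Jacobian C)
    (hdim : 1 ≤ 𝒥.J.dim) (P : AlgPoints C ℂ) :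
    haveI := 𝒥.isDominant_toSchemeHom_negOne
    ∃ (Θ : CartierDivisor 𝒥.J.X.left) (κ' : 𝒥.J.Points ℂ), 𝒥.IsRiemannThetaDivisor Θ ∧ 𝒥.J.IsPrincipalPolarizationDivisor Θ ∧
      (Θ.nonvanishing 1)ᶜ = (𝒥.J.translation κ').left.base ⁻¹' 𝒥.brillNoetherLocus P (𝒥.J.dim - 1) ∧
      (Θ.pullback (AbelianVariety.Hom.toSchemeHom ((-1 : ℤ) • 𝟙 𝒥.J))).SameDivisor Θ := by
  haveI := 𝒥.isDominant_toSchemeHom_negOne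
  haveI := 𝒥.isIso_negOne_zsmul_id
  haveI := hC.geometricallyIrreducible
  -- VI-7: a Riemann theta divisor which is a principal polarisation divisor
  obtain ⟨Θ, h1, h2⟩ := riemann_brillNoetherLocus_isPrincipalPolarizationDivisor_holds C hC 𝒥 hdim
  -- re-centre: `Θ₀ := t_{x₁}^* Θ` has support exactly `W̃(P)`
  obtain ⟨x₁, hsuppΘ⟩ := h1.exists_support_eq_image_translation P
  set Θ₀ : CartierDivisor 𝒥.J.X.left := Θ.pullback (𝒥.J.translation x₁).left with hΘ₀
  have h0 : Θ₀.IsEffective := h1.isEffective.pullback _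
  have hsupp₀ : (Θ₀.nonvanishing 1)ᶜ = 𝒥.brillNoetherLocus P (𝒥.J.dim - 1) := by
    rw [hΘ₀, h1.isEffective.compl_nonvanishing_one_pullback, hsuppΘ, preimage_translation_image_translation]
  have hpr₀ : 𝒥.J.IsPrincipalPolarizationDivisor Θ₀ := h2.pullback_translation x₁
  -- the symmetric translate of `W̃(P)`
  obtain ⟨κ', hκ'⟩ := 𝒥.exists_translate_brillNoetherLocus_symmetric hC P
  set Θ₁ : CartierDivisor 𝒥.J.X.left := Θ₀.pullback (𝒥.J.translation κ').left with hΘ₁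
  have h01 : Θ₁.IsEffective := h0.pullback _
  have hsupp₁ : (Θ₁.nonvanishing 1)ᶜ = (𝒥.J.translation κ').left.base ⁻¹' 𝒥.brillNoetherLocus P (𝒥.J.dim - 1) := by
    rw [hΘ₁, h0.compl_nonvanishing_one_pullback, hsupp₀]
  have hpr₁ : 𝒥.J.IsPrincipalPolarizationDivisor Θ₁ := hpr₀.pullback_translation κ'
  have hirr₁ : IsIrreducible (Θ₁.nonvanishing 1)ᶜ := by
    rw [hsupp₁, ← inv_inv κ', ← 𝒥.image_translation_eq_preimage κ'⁻¹]
    exact 𝒥.isIrreducible_image_translation_brillNoetherLocus P _ κ'⁻¹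
  -- `Θ₁` is a Riemann theta divisor: support `t_{κ'⁻¹}(W̃(P))`
  have hR₁ : 𝒥.IsRiemannThetaDivisor Θ₁ :=
    ⟨h01, P, κ'⁻¹, by rw [hsupp₁, 𝒥.image_translation_eq_preimage κ'⁻¹, inv_inv]⟩
  refine ⟨Θ₁, κ', hR₁, hpr₁, hsupp₁, ?_⟩
  -- `(−1)^*Θ₁` and `Θ₁`: effective principal polarisation divisors with the same irreducible support
  have hs : ((Θ₁.pullback (AbelianVariety.Hom.toSchemeHom ((-1 : ℤ) • 𝟙 𝒥.J))).nonvanishing 1)ᶜ = (Θ₁.nonvanishing 1)ᶜ := by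
    rw [h01.compl_nonvanishing_one_pullback, hsupp₁, hκ']
  exact AbelianVariety.IsPrincipalPolarizationDivisor.sameDivisor_of_support_eq 𝒥.J hdim (h01.pullback _) h01
    (hpr₁.pullback_of_isIso _) hpr₁ hs (hs.symm ▸ hirr₁)

end Jacobian

end Literature.AlgebraicGeometry.Motives

end
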